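import Mathlib
import Summits.Ventures.HodgeRepro.Tier4.Line4.ArchApproxEstimate

/-!
# Tier4/Line4/ArchApprox — C-L4-ARCHAPPROX, part 3: the right `T′_∞`-projection and THE BRIDGE — an `N`-independent
archimedean test `e`, right-`(T′_∞, χ′)`-equivariant, with `archFactor (finf ⋆ e) γ₀ ≠ 0`

Blind re-derivation cell `pub-hodge-repro`, Tier 4 «prove the step» (README §9–§10), seat t4-L1-p1 (prover, LINE L1,
gen 4; the lead's (R-21) S14968 on crit-1's PRECISION 5, Line4 Entry 108 S14967; statements posted S14990).  Tree path
`lean/Summits/Ventures/HodgeRepro/Tier4/Line4/ArchApprox.lean`.  Mathlib-level; no literature.  Part 3 of 3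
(ArchApproxBump → ArchApproxEstimate → ArchApprox).

WHY.  `TailDominated`'s main term is the orbital integral of the CONVOLUTION `(finf ⊗ ffin N) ⋆ f₂ N` (L1Class
`LevelTailDominated`), whose archimedean factor is `archFactor (finf ⋆ (f₂ N)_∞) γ₀` and NOT `archFactor finf γ₀`;
`IsArchCoeff.arch_ne` gives the latter.  The bridge is an `N`-INDEPENDENT archimedean test `e` — continuous, a function of
the archimedean coordinate only, compactly supported on `G_∞`, right-`(T′_∞, χ′)`-equivariant (the `equiv₂` shape of
`TailFamily` through `ChiMatchesAt'`) — with `archFactor (finf ⋆ e) γ₀ ≠ 0`, where `finf ⋆ e = convInf μ_∞ finf e` is the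
archimedean convolution of ConvProduct (`(finf ⋆ e)(x) = ∫_{G_∞} finf(y) e(y⁻¹ x_∞) dμ_∞(y)`, the archimedean factor
of `(finf ⊗ ffin) ⋆ (e ⊗ ffin₂)` by `conv_eq_mul_of_isProductFn`).

WHAT IS PROVED (every declaration sorry-free, axioms `[propext, Classical.choice, Quot.sound]`).
* `projChi' R ν′ e` — the right `T′_∞`-projection `x ↦ ∫_{T′_∞} conj χ′(κ) e(x κ) dν′(κ)` onto the `χ′`-isotypic
  component; it is an `IsInfFactor` (`isInfFactor_projChi'`: continuity of the parametric integral over the compact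
  torus, support inside `supp e · T′_∞⁻¹`), right-`χ′`-equivariant (`projChi'_mul_torus'`: `e(x κ) = χ′(κ) e(x)`, from
  the left invariance of `ν′` and the character law).
* `convInf_projChi'` — Fubini on `G_∞ × T′_∞`: `finf ⋆ projChi' e = projChi' (finf ⋆ e)`;
  `archFactor_projChi'` — Fubini on `T′_∞ × T′_∞` and the right substitution `a′ ↦ a′ κ⁻¹`:
  `archFactor (projChi' F) = ν′(T′_∞) · archFactor F` (the `conj χ′(a′)`-integral of `archFactor` is itself the
  `χ′`-isotypic projection, so the two projections compose to `ν′(T′_∞)` times one);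
  `archFactor_convInf_projChi'` — the two combined: `archFactor (finf ⋆ projChi' e) = ν′(T′_∞) · archFactor (finf ⋆ e)`.
* `exists_infFactor_equivariant_archFactor_convInf_ne_zero` — THE BRIDGE: `e := projChi' (bump)` (ArchApproxEstimate)
  is an equivariant `IsInfFactor` with `archFactor (finf ⋆ e) γ₀ ≠ 0` (`ν′(T′_∞) ≠ 0` is forced by `hne`);
  `exists_infFactor_weightEquivariant_archFactor_convInf_ne_zero` restates the equivariance in the `weightAt'`-form
  of `TailFamily.equiv₂` under `ChiMatchesAt'` at every infinite place (`localTorusAt' W w ⊆ G_∞ ∩ T′`;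
  `χ′(κ) κ₊^{e₊} κ₋^{e₋} = 1` gives `χ′(κ) = κ₊^{−e₊} κ₋^{−e₋}`).

HYPOTHESES (all displayed on the lemmas, none on any target): `μ_∞` a Haar measure on `G_∞`; `ν`, `ν′` finite on the
COMPACT tori `T_∞`, `T′_∞` (`[CompactSpace (torusInf W)]`, `[CompactSpace (torusInf' W)]` — TorusInfCompact /
TorusInfCompactConj on the seesaw plane), `ν′` left AND right invariant (the torus is abelian; the right invariance is
displayed rather than derived); `χ`, `χ′` continuous unit characters (the wall's `hc hu hc' hunit'`); `finf` continuous
and archimedean-only (`IsArchCoeff.cont`, `.infOnly`), `archFactor finf γ₀ ≠ 0` (`IsArchCoeff.arch_ne`).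
Junk: `finf = 0` is excluded by `hne`; `ν′ = 0` is excluded by `hne` too (then `archFactor = 0`, `hreal`).
CONSUMER NOTE: `prodFn W e ffin₂` inherits `TailFamily.equiv₂` from the weight form (`ofFinPart_eq_one_of_mem_infinitePart`,
`ofInfPart_mul`) and `IsTestFn` from `IsInfFactor` + `IsFinFactor` through `gaSplit`.

Nothing here says anything about the status of the Hodge conjecture for CM abelian varieties, which is NOT proved
(HC_CM is NOT proved by anyone in this repository).
-/

set_option autoImplicit false
noncomputable section
namespace Summit.Ventures.HodgeRepro.Tier4.Line4
open Summit.Ventures.HodgeRepro.Tier4 Summit.Ventures.HodgeRepro.Tier4.Common Summit.Ventures.HodgeRepro.Tier4.Line1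
  Summit.Ventures.HodgeRepro.Tier4.Line4.L1Class MeasureTheory NumberField
open scoped ComplexConjugate Topology Pointwise

section ArchApprox

variable {k : Type} [Field k] [NumberField k] (W : PlaneData k) [MeasurableSpace (GA W)] [BorelSpace (GA W)]
/-- **the right `T′_∞`-projection onto the `χ′`-isotypic component**:
`(projChi' e)(x) = ∫_{T′_∞} conj χ′(κ) · e(x κ) dν′(κ)`. -/
def projChi' (R : RTFData W) (νinf' : Measure (torusInf' W)) (e : GA W → ℂ) (x : GA W) : ℂ :=
  ∫ κ : torusInf' W, conj (R.chi' (κ : torusT' W)) * e (x * ((κ : torusT' W) : GA W)) ∂νinf'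

variable (R : RTFData W)

/-- the projection of an archimedean test factor is an archimedean test factor (continuity of the parametric integral
over the compact torus; support inside `supp e · T′_∞⁻¹`). -/
theorem isInfFactor_projChi' (νinf' : Measure (torusInf' W)) [IsFiniteMeasure νinf'] [CompactSpace (torusInf' W)]
    (hc' : Continuous R.chi') {e : GA W → ℂ} (he : IsInfFactor W e) :
    IsInfFactor W (projChi' W R νinf' e) := by
  haveI := t2Space_GA W
  haveI := secondCountable_GA W
  haveI := locallyCompact_GA W
  haveI : SecondCountableTopology (torusT' W) := Topology.IsEmbedding.subtypeVal.secondCountableTopology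
  haveI : SecondCountableTopology (torusInf' W) := Topology.IsEmbedding.subtypeVal.secondCountableTopology
  haveI : IsFiniteMeasureOnCompacts νinf' := ⟨fun _ _ => measure_lt_top νinf' _⟩
  refine ⟨?_, ?_, ?_⟩
  · -- continuity: a parametric integral over the compact torus
    have hunc : Continuous (Function.uncurry fun (x : GA W) (κ : torusInf' W) =>
        conj (R.chi' (κ : torusT' W)) * e (x * ((κ : torusT' W) : GA W))) :=
      (Complex.continuous_conj.comp (hc'.comp (continuous_subtype_val.comp continuous_snd))).mul
        (he.cont.comp (continuous_fst.mul
          ((continuous_subtype_val.comp continuous_subtype_val).comp continuous_snd)))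
    have := continuous_parametric_integral_of_continuous hunc (isCompact_univ (X := torusInf' W))
      (μ := νinf')
    show Continuous fun x : GA W =>
      ∫ κ : torusInf' W, conj (R.chi' (κ : torusT' W)) * e (x * ((κ : torusT' W) : GA W)) ∂νinf'
    simpa [Measure.restrict_univ] using this
  · -- a function of the archimedean coordinate only
    intro x
    unfold projChi'
    congr 1
    funext κ
    have hκ : ((κ : torusT' W) : GA W) ∈ infinitePart W := coe_torusInf'_mem_infinitePart W κ
    congr 1
    rw [he.infOnly (x * _), he.infOnly (GA.ofInfPart W x * _), ofInfPart_mul, ofInfPart_mul,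
      ofInfPart_eq_self_of_mem_infinitePart W (GA.ofInfPart_mem_infinitePart W x)]
  · -- compact support on `G_∞`: inside `supp e · T′_∞⁻¹`
    set S : Set (infinitePart W) := tsupport (fun y : infinitePart W => e (y : GA W)) with hS
    have hSc : IsCompact S := he.compact
    have hTc : IsCompact (Set.range (torusInf'ToInf W)) :=
      isCompact_range (continuous_torusInf'ToInf W)
    refine HasCompactSupport.intro (hSc.mul hTc.inv) fun y hy => ?_
    show (∫ κ : torusInf' W, conj (R.chi' (κ : torusT' W)) * e ((y : GA W) * ((κ : torusT' W) : GA W)) ∂νinf') = 0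
    have hzero : ∀ κ : torusInf' W, e ((y : GA W) * ((κ : torusT' W) : GA W)) = 0 := by
      intro κ
      by_contra hne
      apply hy
      have hmem : y * torusInf'ToInf W κ ∈ S := by
        apply subset_tsupport
        show e (((y * torusInf'ToInf W κ : infinitePart W) : GA W)) ≠ 0
        simpa [torusInf'ToInf] using hne
      refine ⟨y * torusInf'ToInf W κ, hmem, (torusInf'ToInf W κ)⁻¹,
        Set.inv_mem_inv.2 ⟨κ, rfl⟩, ?_⟩
      simp
    simp [hzero]

/-- the projection is right-`(T′_∞, χ′)`-equivariant: `(projChi' e)(x κ) = χ′(κ) · (projChi' e)(x)` (left invariance of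
`ν′` and the character law `χ′(κ⁻¹ κ′) = conj χ′(κ) χ′(κ′)` for a unit character). -/
theorem projChi'_mul_torus' (νinf' : Measure (torusInf' W)) [νinf'.IsMulLeftInvariant]
    (hu' : ∀ a, ‖R.chi' a‖ = 1) (e : GA W → ℂ) (κ : torusInf' W) (x : GA W) :
    projChi' W R νinf' e (x * ((κ : torusT' W) : GA W)) = R.chi' (κ : torusT' W) * projChi' W R νinf' e x := by
  haveI := t2Space_GA W
  haveI := secondCountable_GA W
  haveI : SecondCountableTopology (torusT' W) := Topology.IsEmbedding.subtypeVal.secondCountableTopology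
  haveI : SecondCountableTopology (torusInf' W) := Topology.IsEmbedding.subtypeVal.secondCountableTopology
  unfold projChi'
  rw [← integral_const_mul]
  have hsub := integral_mul_left_eq_self (μ := νinf') (fun κ' : torusInf' W =>
    conj (R.chi' (κ' : torusT' W)) * e (x * ((κ : torusT' W) : GA W) * ((κ' : torusT' W) : GA W))) κ⁻¹
  rw [← hsub]
  congr 1
  funext κ'
  show conj (R.chi' ((κ⁻¹ * κ' : torusInf' W) : torusT' W)) *
      e (x * ((κ : torusT' W) : GA W) * (((κ⁻¹ * κ' : torusInf' W) : torusT' W) : GA W)) =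
    R.chi' (κ : torusT' W) * (conj (R.chi' (κ' : torusT' W)) * e (x * ((κ' : torusT' W) : GA W)))
  have harg : x * ((κ : torusT' W) : GA W) * (((κ⁻¹ * κ' : torusInf' W) : torusT' W) : GA W) =
      x * ((κ' : torusT' W) : GA W) := by
    simp [mul_assoc]
  have hchi : conj (R.chi' ((κ⁻¹ * κ' : torusInf' W) : torusT' W)) =
      R.chi' (κ : torusT' W) * conj (R.chi' (κ' : torusT' W)) := by
    rw [Subgroup.coe_mul, Subgroup.coe_inv]
    exact conj_chi'_inv_mul W R hu' _ _
  rw [harg, hchi]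
  ring

set_option synthInstance.maxHeartbeats 200000 in
/-- **Fubini**: `finf ⋆ projChi' e = projChi' (finf ⋆ e)` pointwise (the joint integrand is continuous with compact
support in `(y, κ) ∈ G_∞ × T′_∞`). -/
theorem convInf_projChi' (μinf : Measure (infinitePart W)) [μinf.IsHaarMeasure]
    (νinf' : Measure (torusInf' W)) [IsFiniteMeasure νinf'] [CompactSpace (torusInf' W)]
    (hc' : Continuous R.chi') {finf : GA W → ℂ} (hfinf : Continuous finf) {e : GA W → ℂ}
    (he : IsInfFactor W e) (x : GA W) :
    convInf W μinf finf (projChi' W R νinf' e) x = projChi' W R νinf' (convInf W μinf finf e) x := by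
  haveI := locallyCompact_infinitePart W
  haveI := secondCountable_infinitePart W
  haveI := t2Space_GA W
  haveI := secondCountable_GA W
  haveI : SecondCountableTopology (torusT' W) := Topology.IsEmbedding.subtypeVal.secondCountableTopology
  haveI : SecondCountableTopology (torusInf' W) := Topology.IsEmbedding.subtypeVal.secondCountableTopology
  haveI : IsFiniteMeasureOnCompacts νinf' := ⟨fun _ _ => measure_lt_top νinf' _⟩
  -- the joint integrand
  let F : infinitePart W → torusInf' W → ℂ := fun y κ =>
    finf y * (conj (R.chi' (κ : torusT' W)) *
      e ((y : GA W)⁻¹ * GA.ofInfPart W x * ((κ : torusT' W) : GA W)))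
  have hFc : Continuous (Function.uncurry F) := by
    apply Continuous.mul
    · exact hfinf.comp (continuous_subtype_val.comp continuous_fst)
    · apply Continuous.mul
      · exact Complex.continuous_conj.comp (hc'.comp (continuous_subtype_val.comp continuous_snd))
      · exact he.cont.comp (((continuous_subtype_val.comp continuous_fst).inv.mul continuous_const).mul
          ((continuous_subtype_val.comp continuous_subtype_val).comp continuous_snd))
  -- compact support: `y ∈ x_∞ · T′_∞ · S⁻¹`
  have hFs : HasCompactSupport (Function.uncurry F) := by
    set S : Set (infinitePart W) := tsupport (fun y : infinitePart W => e (y : GA W)) with hS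
    have hSc : IsCompact S := he.compact
    have hTc : IsCompact (Set.range (torusInf'ToInf W)) :=
      isCompact_range (continuous_torusInf'ToInf W)
    refine HasCompactSupport.intro
      ((((isCompact_singleton (x := infOf W x)).mul hTc).mul hSc.inv).prod isCompact_univ) ?_
    rintro ⟨y, κ⟩ hyκ
    by_contra hne
    apply hyκ
    refine ⟨?_, Set.mem_univ _⟩
    have hcoe : (y : GA W)⁻¹ * GA.ofInfPart W x * ((κ : torusT' W) : GA W) =
        ((y⁻¹ * infOf W x * torusInf'ToInf W κ : infinitePart W) : GA W) := by
      simp [torusInf'ToInf, coe_infOf]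
    have hmem : y⁻¹ * infOf W x * torusInf'ToInf W κ ∈ S := by
      apply subset_tsupport
      show e (((y⁻¹ * infOf W x * torusInf'ToInf W κ : infinitePart W) : GA W)) ≠ 0
      intro h0
      apply hne
      show F y κ = 0
      simp only [F]
      rw [hcoe, h0, mul_zero, mul_zero]
    refine ⟨infOf W x * torusInf'ToInf W κ, ⟨infOf W x, rfl, torusInf'ToInf W κ, ⟨κ, rfl⟩, rfl⟩,
      (y⁻¹ * infOf W x * torusInf'ToInf W κ)⁻¹, Set.inv_mem_inv.2 hmem, ?_⟩
    simp [mul_assoc]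
  have hFi : Integrable (Function.uncurry F) (μinf.prod νinf') :=
    hFc.integrable_of_hasCompactSupport hFs
  have hL : convInf W μinf finf (projChi' W R νinf' e) x = ∫ y, ∫ κ, F y κ ∂νinf' ∂μinf := by
    unfold convInf projChi'
    congr 1
    funext y
    rw [← integral_const_mul]
  have hR : projChi' W R νinf' (convInf W μinf finf e) x = ∫ κ, ∫ y, F y κ ∂μinf ∂νinf' := by
    unfold projChi' convInf
    congr 1
    funext κ
    rw [← integral_const_mul]
    congr 1
    funext y
    have hκ : GA.ofInfPart W (x * ((κ : torusT' W) : GA W)) = GA.ofInfPart W x * ((κ : torusT' W) : GA W) := by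
      rw [ofInfPart_mul, ofInfPart_eq_self_of_mem_infinitePart W (coe_torusInf'_mem_infinitePart W κ)]
    rw [hκ]
    simp only [F, mul_assoc]
    ring
  rw [hL, hR, integral_integral_swap hFi]

set_option synthInstance.maxHeartbeats 200000 in
/-- **the `χ′`-projection is absorbed by `archFactor`**: `archFactor (projChi' F) = ν′(T′_∞) · archFactor F` for
continuous `F` (Fubini on `T′_∞ × T′_∞`, the right substitution `a′ ↦ a′ κ⁻¹` and the unit character law). -/
theorem archFactor_projChi' (νinf : Measure (torusInf W)) (νinf' : Measure (torusInf' W))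
    [IsFiniteMeasure νinf] [IsFiniteMeasure νinf'] [νinf'.IsMulRightInvariant]
    [CompactSpace (torusInf W)] [CompactSpace (torusInf' W)]
    (hc' : Continuous R.chi') (hu' : ∀ a, ‖R.chi' a‖ = 1)
    {F : GA W → ℂ} (hF : Continuous F) (γ₀ : GA W) :
    archFactor W R (projChi' W R νinf' F) γ₀ νinf νinf' =
      (νinf'.real Set.univ : ℂ) * archFactor W R F γ₀ νinf νinf' := by
  haveI := t2Space_GA W
  haveI := secondCountable_GA W
  haveI : SecondCountableTopology (torusT' W) := Topology.IsEmbedding.subtypeVal.secondCountableTopology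
  haveI : SecondCountableTopology (torusInf' W) := Topology.IsEmbedding.subtypeVal.secondCountableTopology
  haveI : IsFiniteMeasureOnCompacts νinf' := ⟨fun _ _ => measure_lt_top νinf' _⟩
  unfold archFactor
  rw [← integral_const_mul]
  congr 1
  funext a
  rw [← mul_assoc, mul_comm (νinf'.real Set.univ : ℂ) (R.chi _), mul_assoc]
  congr 1
  set z : GA W := ((a : torusT W) : GA W)⁻¹ * γ₀ with hz
  let G : torusInf' W → torusInf' W → ℂ := fun a' κ =>
    conj (R.chi' (a' : torusT' W)) * (conj (R.chi' (κ : torusT' W)) *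
      F (z * ((a' : torusT' W) : GA W) * ((κ : torusT' W) : GA W)))
  have hGc : Continuous (Function.uncurry G) := by
    apply Continuous.mul
    · exact Complex.continuous_conj.comp (hc'.comp (continuous_subtype_val.comp continuous_fst))
    · apply Continuous.mul
      · exact Complex.continuous_conj.comp (hc'.comp (continuous_subtype_val.comp continuous_snd))
      · exact hF.comp ((continuous_const.mul
          ((continuous_subtype_val.comp continuous_subtype_val).comp continuous_fst)).mul
          ((continuous_subtype_val.comp continuous_subtype_val).comp continuous_snd))
  have hGi : Integrable (Function.uncurry G) (νinf'.prod νinf') :=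
    hGc.integrable_of_hasCompactSupport (HasCompactSupport.of_compactSpace _)
  have h1 : (∫ a' : torusInf' W, conj (R.chi' (a' : torusT' W)) *
      projChi' W R νinf' F (z * ((a' : torusT' W) : GA W)) ∂νinf') = ∫ a', ∫ κ, G a' κ ∂νinf' ∂νinf' := by
    congr 1
    funext a'
    unfold projChi'
    rw [← integral_const_mul]
  rw [h1, integral_integral_swap hGi]
  have h2 : ∀ κ : torusInf' W, (∫ a', G a' κ ∂νinf') =
      ∫ b : torusInf' W, conj (R.chi' (b : torusT' W)) * F (z * ((b : torusT' W) : GA W)) ∂νinf' := by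
    intro κ
    have hsub := integral_mul_right_eq_self (μ := νinf') (fun b : torusInf' W =>
      conj (R.chi' ((b * κ⁻¹ : torusInf' W) : torusT' W)) *
        (conj (R.chi' (κ : torusT' W)) * F (z * ((b : torusT' W) : GA W)))) κ
    have hL : (∫ a', G a' κ ∂νinf') = ∫ b : torusInf' W, (fun b : torusInf' W =>
        conj (R.chi' ((b * κ⁻¹ : torusInf' W) : torusT' W)) *
          (conj (R.chi' (κ : torusT' W)) * F (z * ((b : torusT' W) : GA W)))) (b * κ) ∂νinf' := by
      congr 1
      funext b
      simp only [G, Subgroup.coe_mul, mul_inv_cancel, mul_one, mul_assoc]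
    rw [hL, hsub]
    congr 1
    funext b
    have hk : R.chi' (κ : torusT' W) * conj (R.chi' (κ : torusT' W)) = 1 := by
      rw [Complex.mul_conj, Complex.normSq_eq_norm_sq, hu']
      simp
    rw [Subgroup.coe_mul, Subgroup.coe_inv, conj_chi'_mul_inv W R hu']
    calc conj (R.chi' (b : torusT' W)) * R.chi' (κ : torusT' W) *
          (conj (R.chi' (κ : torusT' W)) * F (z * ((b : torusT' W) : GA W)))
        = conj (R.chi' (b : torusT' W)) * (R.chi' (κ : torusT' W) * conj (R.chi' (κ : torusT' W))) *
          F (z * ((b : torusT' W) : GA W)) := by ring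
      _ = conj (R.chi' (b : torusT' W)) * F (z * ((b : torusT' W) : GA W)) := by rw [hk, mul_one]
  simp_rw [h2]
  rw [integral_const, Complex.real_smul]

/-- **the projection is absorbed by the archimedean factor**: `archFactor (finf ⋆ projChi' e) = ν′(T′_∞) · archFactor
(finf ⋆ e)` — Fubini (`finf ⋆ projChi' e = projChi' (finf ⋆ e)`), the right invariance of `ν′` and the character law
(the `conj χ′(a′)`-integral of `archFactor` is the `χ′`-isotypic projection, which composes with itself to `ν′(T′_∞)`
times one). -/
theorem archFactor_convInf_projChi'
    (μinf : Measure (infinitePart W)) [μinf.IsHaarMeasure]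
    (νinf : Measure (torusInf W)) (νinf' : Measure (torusInf' W)) [IsFiniteMeasure νinf] [IsFiniteMeasure νinf']
    [νinf'.IsMulRightInvariant] [CompactSpace (torusInf W)] [CompactSpace (torusInf' W)]
    (hc' : Continuous R.chi') (hu' : ∀ a, ‖R.chi' a‖ = 1)
    {finf : GA W → ℂ} (hfinf : Continuous finf) {e : GA W → ℂ} (he : IsInfFactor W e) (γ₀ : GA W) :
    archFactor W R (convInf W μinf finf (projChi' W R νinf' e)) γ₀ νinf νinf' =
      (νinf'.real Set.univ : ℂ) * archFactor W R (convInf W μinf finf e) γ₀ νinf νinf' := by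
  have hfun : convInf W μinf finf (projChi' W R νinf' e) = projChi' W R νinf' (convInf W μinf finf e) :=
    funext (convInf_projChi' W R μinf νinf' hc' hfinf he)
  rw [hfun]
  exact archFactor_projChi' W R νinf νinf' hc' hu' (continuous_convInf_of_isInfFactor W μinf hfinf he) γ₀

/-- **C-L4-ARCHAPPROX — THE BRIDGE**: for `finf` continuous with `archFactor finf γ₀ ≠ 0` there is an `N`-INDEPENDENT
archimedean test factor `e` — continuous, a function of the archimedean coordinate only, compactly supported on `G_∞`,
right-`(T′_∞, χ′)`-equivariant — with `archFactor (finf ⋆ e) γ₀ ≠ 0` (`finf ⋆ e = convInf μ_∞ finf e`, the archimedean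
factor of `(finf ⊗ ffin) ⋆ (e ⊗ ffin₂)` by ConvProduct). -/
theorem exists_infFactor_equivariant_archFactor_convInf_ne_zero
    (μinf : Measure (infinitePart W)) [μinf.IsHaarMeasure]
    (νinf : Measure (torusInf W)) (νinf' : Measure (torusInf' W)) [IsFiniteMeasure νinf] [IsFiniteMeasure νinf']
    [νinf'.IsMulLeftInvariant] [νinf'.IsMulRightInvariant]
    [CompactSpace (torusInf W)] [CompactSpace (torusInf' W)]
    (hc : Continuous R.chi) (hu : ∀ a, ‖R.chi a‖ = 1) (hc' : Continuous R.chi') (hu' : ∀ a, ‖R.chi' a‖ = 1)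
    {finf : GA W → ℂ} (hfinf : Continuous finf) (hinf : ∀ x, finf x = finf (GA.ofInfPart W x)) (γ₀ : GA W)
    (hne : archFactor W R finf γ₀ νinf νinf' ≠ 0) :
    ∃ e : GA W → ℂ, IsInfFactor W e ∧
      (∀ (κ : torusInf' W) (x : GA W), e (x * ((κ : torusT' W) : GA W)) = R.chi' (κ : torusT' W) * e x) ∧
      archFactor W R (convInf W μinf finf e) γ₀ νinf νinf' ≠ 0 := by
  obtain ⟨e₀, he₀, hne₀⟩ := exists_bump_archFactor_convInf_ne_zero W R μinf νinf νinf' hc hu hc' hu'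
    hfinf hinf γ₀ hne
  -- `ν′ ≠ 0`, hence `ν′(T′_∞) ≠ 0`
  have hν' : νinf' ≠ 0 := by
    intro h0
    apply hne
    unfold archFactor
    simp [h0]
  have hreal : (νinf'.real Set.univ : ℂ) ≠ 0 := by
    rw [Ne, Complex.ofReal_eq_zero, Measure.real, ENNReal.toReal_eq_zero_iff, not_or]
    exact ⟨fun h => hν' (Measure.measure_univ_eq_zero.1 h), measure_ne_top _ _⟩
  refine ⟨projChi' W R νinf' e₀, isInfFactor_projChi' W R νinf' hc' he₀,
    fun κ x => projChi'_mul_torus' W R νinf' hu' e₀ κ x, ?_⟩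
  rw [archFactor_convInf_projChi' W R μinf νinf νinf' hc' hu' hfinf he₀ γ₀]
  exact mul_ne_zero hreal hne₀

/-- the equivariance of the bridge test in the `weightAt'`-form of `TailFamily.equiv₂`, from `ChiMatchesAt'` at every
infinite place (`localTorusAt' W w ⊆ G_∞ ∩ T′`, so `κ ∈ T′_w` is an element of `T′_∞`; `χ′(κ) · κ₊^{e₊} κ₋^{e₋} = 1`
gives `χ′(κ) = κ₊^{−e₊} κ₋^{−e₋}`). -/
theorem exists_infFactor_weightEquivariant_archFactor_convInf_ne_zero
    (μinf : Measure (infinitePart W)) [μinf.IsHaarMeasure]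
    (νinf : Measure (torusInf W)) (νinf' : Measure (torusInf' W)) [IsFiniteMeasure νinf] [IsFiniteMeasure νinf']
    [νinf'.IsMulLeftInvariant] [νinf'.IsMulRightInvariant]
    [CompactSpace (torusInf W)] [CompactSpace (torusInf' W)]
    (hc : Continuous R.chi) (hu : ∀ a, ‖R.chi a‖ = 1) (hc' : Continuous R.chi') (hu' : ∀ a, ‖R.chi' a‖ = 1)
    (q : QuadData k) (g g' : Matrix (Fin 4) (Fin 4) k) (eP' eM' : InfinitePlace k → ℤ)
    (hmatch' : ∀ w, ChiMatchesAt' W q w g g' (eP' w) (eM' w) R.chi')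
    {finf : GA W → ℂ} (hfinf : Continuous finf) (hinf : ∀ x, finf x = finf (GA.ofInfPart W x)) (γ₀ : GA W)
    (hne : archFactor W R finf γ₀ νinf νinf' ≠ 0) :
    ∃ e : GA W → ℂ, IsInfFactor W e ∧
      (∀ (w : InfinitePlace k) (κ : GA W), κ ∈ localTorusAt' W w → ∀ x,
        e (x * κ) = weightAt' W q w g g' 0 κ ^ (-eP' w) * weightAt' W q w g g' 1 κ ^ (-eM' w) * e x) ∧
      archFactor W R (convInf W μinf finf e) γ₀ νinf νinf' ≠ 0 := by
  obtain ⟨e, he, hequiv, hne'⟩ := exists_infFactor_equivariant_archFactor_convInf_ne_zero W R μinf νinf νinf'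
    hc hu hc' hu' hfinf hinf γ₀ hne
  refine ⟨e, he, fun w κ hκ x => ?_, hne'⟩
  have hκT : κ ∈ torusT' W := hκ.1
  have hκinf : κ ∈ infinitePart W := localTorusAt'_subset_infinitePart W w hκ
  let κ' : torusInf' W := ⟨⟨κ, hκT⟩, Subgroup.mem_subgroupOf.2 hκinf⟩
  have h1 : e (x * κ) = R.chi' ⟨κ, hκT⟩ * e x := hequiv κ' x
  have h2 := hmatch' w ⟨κ, hκT⟩ hκ
  have h3 : R.chi' ⟨κ, hκT⟩ =
      weightAt' W q w g g' 0 κ ^ (-eP' w) * weightAt' W q w g g' 1 κ ^ (-eM' w) := by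
    rw [zpow_neg, zpow_neg, ← mul_inv]
    apply eq_inv_of_mul_eq_one_left
    rw [← mul_assoc]
    exact h2
  rw [h1, h3]

end ArchApprox

end Summit.Ventures.HodgeRepro.Tier4.Line4

end
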